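import Summits.AtomisticToContinuum.Crystallization.Theorems.HullExactificationCascadeHullExactShellsLimits

/-!
# `HullExactShells` (route `HullExactificationCascade`, item stmt-AtomisticToContinuum-12092):
# shell congruence passes to local limits

Helper file (supports `HullExactificationCascade.HullExactShells`).  For a point set `X` of a real
normed space `E`, a point `y` and a radius `r`, the (punctured, open) `r`-shell of `y` in `X` is
`{w | w ∈ X ∧ w ≠ y ∧ dist w y < r}`; it is `η`-congruent to a pattern `P ⊆ E` if there are a
linear isometry `A` and a bijection `e : shell ≃ P` with `dist (t - y) (A (e t)) ≤ η` for every
`t` in the shell (the route's inline `η`-goodness, with `E = ℝ³`, `r = 13/10·a` and `P` the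
punctured `13/10·a`-shell of the hcp stacking at `0`).

* `good_transfer` — congruence is transported along a bijection of shells that moves the
  recentred points by at most `θ` (tolerance `θ + η`);
* `good_preimage_add_const` — congruence is translation covariant;
* `exists_matching_equiv` — a two-way `ε`-matching of separated sets restricts to a bijection
  between shells that stay `2ε` inside the open cutoff;
* `good_of_limit` (in `ℝ³`) — **shell congruence passes to local limits**: if `X_k → X` locally
  (two-way `ε`-matching on every ball, eventually), all sets are `δ`-separated, every `p ∈ P` has
  `‖p‖ < r`, and for every `η > 0`, eventually in `k`, every point of `X_k` of norm `≤ ‖y‖ + 1`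
  has an `η`-congruent shell, then the shell of `y ∈ X` is `η`-congruent to `P` for every `η > 0`
  (finitely many points, so both shells stay a fixed margin inside the open cutoff).

All `[folklore]`; Mathlib + `LocalMatchingCompactness.lean` (through the sibling helper file
`HullExactificationCascadeHullExactShellsLimits.lean`); no new definitions; nothing here closes an
item.
-/

noncomputable section

namespace Summit.AtomisticToContinuum.Crystallization.Theorems.HullExactShells

open scoped Topology
open Filter Set Metric
open Literature.MathematicalPhysics.StatisticalMechanics

/-! ## A supply of small tolerances -/

/-- A positive real below five given positive reals. [folklore] -/
theorem exists_pos_le_five {a b c d e : ℝ} (ha : 0 < a) (hb : 0 < b) (hc : 0 < c) (hd : 0 < d)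
    (he : 0 < e) : ∃ ε : ℝ, 0 < ε ∧ ε ≤ a ∧ ε ≤ b ∧ ε ≤ c ∧ ε ≤ d ∧ ε ≤ e := by
  refine ⟨min a (min b (min c (min d e))), lt_min ha (lt_min hb (lt_min hc (lt_min hd he))),
    min_le_left _ _, ?_, ?_, ?_, ?_⟩
  · exact (min_le_right _ _).trans (min_le_left _ _)
  · exact (min_le_right _ _).trans ((min_le_right _ _).trans (min_le_left _ _))
  · exact (min_le_right _ _).trans ((min_le_right _ _).trans ((min_le_right _ _).trans
      (min_le_left _ _)))
  · exact (min_le_right _ _).trans ((min_le_right _ _).trans ((min_le_right _ _).trans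
      (min_le_right _ _)))

section Metric

variable {E : Type*} [NormedAddCommGroup E]

/-! ## Margins of finite shells -/

/-- A finite set of points of norm `< r` stays a positive margin below `r`. [folklore] -/
theorem exists_margin_norm {P : Set E} (hP : P.Finite) {r : ℝ} (hr : 0 < r)
    (hPr : ∀ p ∈ P, ‖p‖ < r) : ∃ m : ℝ, 0 < m ∧ ∀ p ∈ P, ‖p‖ + m ≤ r := by
  rcases P.eq_empty_or_nonempty with rfl | hne
  · exact ⟨r, hr, fun p hp => absurd hp (Set.notMem_empty p)⟩
  · obtain ⟨p₀, hp₀, hmax⟩ := Set.exists_max_image P (fun p => ‖p‖) hP hne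
    refine ⟨r - ‖p₀‖, by linarith [hPr p₀ hp₀], fun p hp => ?_⟩
    linarith [hmax p hp]

/-- A finite set of points at distance `< r` from `y` stays a positive margin below `r`.
[folklore] -/
theorem exists_margin_dist {T : Set E} (hT : T.Finite) {y : E} {r : ℝ} (hr : 0 < r)
    (hTr : ∀ t ∈ T, dist t y < r) : ∃ m : ℝ, 0 < m ∧ ∀ t ∈ T, dist t y + m ≤ r := by
  rcases T.eq_empty_or_nonempty with rfl | hne
  · exact ⟨r, hr, fun p hp => absurd hp (Set.notMem_empty p)⟩
  · obtain ⟨p₀, hp₀, hmax⟩ := Set.exists_max_image T (fun p => dist p y) hT hne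
    refine ⟨r - dist p₀ y, by linarith [hTr p₀ hp₀], fun p hp => ?_⟩
    linarith [hmax p hp]

/-! ## Matchings restrict to bijections of shells -/

/-- In a `δ`-separated set two points within `ε` of a common point coincide once `2ε < δ`.
[folklore] -/
theorem eq_of_dist_le_of_sep {S : Set E} {δ ε : ℝ}
    (hsep : ∀ p ∈ S, ∀ q ∈ S, p ≠ q → δ ≤ dist p q) (hε : 2 * ε < δ)
    {a b c : E} (ha : a ∈ S) (hb : b ∈ S) (hac : dist a c ≤ ε) (hbc : dist b c ≤ ε) : a = b := by
  by_contra hab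
  have h := hsep a ha b hb hab
  have : dist a b ≤ 2 * ε :=
    calc dist a b ≤ dist a c + dist b c := dist_triangle_right _ _ _
      _ ≤ ε + ε := add_le_add hac hbc
      _ = 2 * ε := by ring
  linarith

/-- The translation bijection between the shell of `z` in `X - v = (· + v) ⁻¹' X` and the shell of
`z + v` in `X`. [folklore] -/
theorem exists_shell_equiv_preimage_add_const (X : Set E) (z v : E) (r : ℝ) :
    ∃ b : ↥{w | w ∈ (fun p => p + v) ⁻¹' X ∧ w ≠ z ∧ dist w z < r} ≃
        ↥{w | w ∈ X ∧ w ≠ z + v ∧ dist w (z + v) < r},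
      ∀ t : ↥{w | w ∈ (fun p => p + v) ⁻¹' X ∧ w ≠ z ∧ dist w z < r},
        ((b t : ↥{w | w ∈ X ∧ w ≠ z + v ∧ dist w (z + v) < r}) : E) = (t : E) + v := by
  refine ⟨{ toFun := fun t => ⟨(t : E) + v, t.2.1, fun h' => t.2.2.1 (add_right_cancel h'), ?_⟩
            invFun := fun t' => ⟨(t' : E) - v, ?_, fun h' => t'.2.2.1 (eq_add_of_sub_eq h'), ?_⟩
            left_inv := fun t => Subtype.ext (add_sub_cancel_right (t : E) v)
            right_inv := fun t' => Subtype.ext (sub_add_cancel (t' : E) v) }, fun t => rfl⟩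
  · have h3 := t.2.2.2
    rwa [← dist_add_right _ _ v] at h3
  · show (t' : E) - v + v ∈ X
    rw [sub_add_cancel]
    exact t'.2.1
  · have h3 := t'.2.2.2
    rwa [← dist_sub_right _ _ v, add_sub_cancel_right] at h3

/-- **Matchings restrict to bijections of shells.** Let `X`, `X'` be `δ`-separated and two-way
`ε`-matched on the ball of radius `‖y‖ + r + 1` about `0` (`2ε < δ`, `ε ≤ 1`), `y ∈ X`, and
`y' ∈ X'` a partner of `y` (`dist y' y ≤ ε`).  If the `r`-shells of `y` in `X` and of `y'` in
`X'` stay `2ε` inside the open cutoff `r`, the matching restricts to a bijection between them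
moving the recentred points by at most `2ε`. [folklore] -/
theorem exists_matching_equiv {X X' : Set E} {δ ε r : ℝ} {y y' : E}
    (hsep : ∀ p ∈ X, ∀ q ∈ X, p ≠ q → δ ≤ dist p q)
    (hsep' : ∀ p ∈ X', ∀ q ∈ X', p ≠ q → δ ≤ dist p q) (h2ε : 2 * ε < δ) (hε1 : ε ≤ 1)
    (hM : BallMatch ε (‖y‖ + r + 1) 0 X' X) (hy : y ∈ X) (hy' : y' ∈ X')
    (hyy' : dist y' y ≤ ε)
    (hT : ∀ t ∈ X, t ≠ y → dist t y < r → dist t y + 2 * ε < r)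
    (hT' : ∀ t' ∈ X', t' ≠ y' → dist t' y' < r → dist t' y' + 2 * ε < r) :
    ∃ b : ↥{w | w ∈ X ∧ w ≠ y ∧ dist w y < r} ≃ ↥{w | w ∈ X' ∧ w ≠ y' ∧ dist w y' < r},
      ∀ t : ↥{w | w ∈ X ∧ w ≠ y ∧ dist w y < r},
        dist ((t : E) - y) (((b t : ↥{w | w ∈ X' ∧ w ≠ y' ∧ dist w y' < r}) : E) - y') ≤
          2 * ε := by
  classical
  have hε0 : 0 ≤ ε := dist_nonneg.trans hyy'
  -- the matching map `f : T → T'`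
  have hf0 : ∀ t : ↥{w | w ∈ X ∧ w ≠ y ∧ dist w y < r},
      ∃ a : ↥{w | w ∈ X' ∧ w ≠ y' ∧ dist w y' < r}, dist (a : E) t ≤ ε := fun t => by
    obtain ⟨htX, hty, htr⟩ := t.2
    have htR : dist (t : E) 0 ≤ ‖y‖ + r + 1 := by
      rw [dist_zero_right]
      linarith [norm_le_norm_add_dist (t : E) y]
    obtain ⟨a, ha, hat⟩ := hM.1 (t : E) htX htR
    have hty' : δ ≤ dist (t : E) y := hsep _ htX _ hy hty
    have h1 : dist a y' ≤ dist a t + dist (t : E) y + dist y' y := by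
      linarith [dist_triangle4 a (t : E) y y', dist_comm y y']
    have h2 : dist (t : E) y ≤ dist a t + dist a y' + dist y' y := by
      linarith [dist_triangle4 (t : E) a y' y, dist_comm a (t : E)]
    have hpos : 0 < dist a y' := by linarith
    have h3 := hT (t : E) htX hty htr
    refine ⟨⟨a, ha, fun hay' => ?_, ?_⟩, hat⟩
    · rw [hay', dist_self] at hpos
      exact lt_irrefl _ hpos
    · show dist a y' < r
      linarith
  choose f hf using hf0
  -- the matching map `g : T' → T`
  have hg0 : ∀ t' : ↥{w | w ∈ X' ∧ w ≠ y' ∧ dist w y' < r},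
      ∃ s : ↥{w | w ∈ X ∧ w ≠ y ∧ dist w y < r}, dist (t' : E) s ≤ ε := fun t' => by
    obtain ⟨ht'X, ht'y, ht'r⟩ := t'.2
    have ht'R : dist (t' : E) 0 ≤ ‖y‖ + r + 1 := by
      rw [dist_zero_right]
      linarith [norm_le_norm_add_dist (t' : E) y', norm_le_norm_add_dist y' y]
    obtain ⟨s, hs, hst⟩ := hM.2 (t' : E) ht'X ht'R
    have hty' : δ ≤ dist (t' : E) y' := hsep' _ ht'X _ hy' ht'y
    have h1 : dist s y ≤ dist (t' : E) s + dist (t' : E) y' + dist y' y := by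
      linarith [dist_triangle4 s (t' : E) y' y, dist_comm s (t' : E)]
    have h2 : dist (t' : E) y' ≤ dist (t' : E) s + dist s y + dist y' y := by
      linarith [dist_triangle4 (t' : E) s y y', dist_comm y y']
    have hpos : 0 < dist s y := by linarith
    have h3 := hT' (t' : E) ht'X ht'y ht'r
    refine ⟨⟨s, hs, fun hsy => ?_, ?_⟩, hst⟩
    · rw [hsy, dist_self] at hpos
      exact lt_irrefl _ hpos
    · show dist s y < r
      linarith
  choose g hg using hg0
  -- mutually inverse (uniqueness of partners in separated sets)
  have hgf : ∀ t, g (f t) = t := fun t =>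
    Subtype.ext (eq_of_dist_le_of_sep hsep h2ε (g (f t)).2.1 t.2.1
      (by rw [dist_comm]; exact hg (f t)) (by rw [dist_comm]; exact hf t))
  have hfg : ∀ t', f (g t') = t' := fun t' =>
    Subtype.ext (eq_of_dist_le_of_sep hsep' h2ε (f (g t')).2.1 t'.2.1 (hf (g t')) (hg t'))
  refine ⟨⟨f, g, hgf, hfg⟩, fun t => ?_⟩
  show dist ((t : E) - y) ((f t : E) - y') ≤ 2 * ε
  calc dist ((t : E) - y) ((f t : E) - y') = ‖((t : E) - f t) - (y - y')‖ := by
        rw [dist_eq_norm]; congr 1; abel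
    _ ≤ ‖(t : E) - f t‖ + ‖y - y'‖ := norm_sub_le _ _
    _ = dist (f t : E) t + dist y' y := by
        rw [← dist_eq_norm, ← dist_eq_norm, dist_comm, dist_comm y]
    _ ≤ ε + ε := add_le_add (hf t) hyy'
    _ = 2 * ε := by ring

end Metric

section Normed

variable {E : Type*} [NormedAddCommGroup E] [NormedSpace ℝ E]

/-! ## Transport of shell congruence -/

/-- Shell congruence is transported along a bijection `b : T ≃ T'` of shells under which the
recentred points move by at most `θ`: an `η`-congruence of `T'` (centred at `y'`) to `P` gives a
`(θ + η)`-congruence of `T` (centred at `y`) to `P`, with the same isometry. [folklore] -/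
theorem good_transfer {T T' P : Set E} {y y' : E} {η θ η' : ℝ} (b : ↥T ≃ ↥T')
    (hb : ∀ t : ↥T, dist ((t : E) - y) ((b t : E) - y') ≤ θ)
    (h : ∃ A : E →ₗᵢ[ℝ] E, ∃ e : ↥T' ≃ ↥P,
      ∀ t' : ↥T', dist ((t' : E) - y') (A ((e t' : ↥P) : E)) ≤ η)
    (hθη : θ + η ≤ η') :
    ∃ A : E →ₗᵢ[ℝ] E, ∃ e : ↥T ≃ ↥P, ∀ t : ↥T, dist ((t : E) - y) (A ((e t : ↥P) : E)) ≤ η' := by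
  obtain ⟨A, e, he⟩ := h
  refine ⟨A, b.trans e, fun t => ?_⟩
  calc dist ((t : E) - y) (A ((e (b t) : ↥P) : E))
      ≤ dist ((t : E) - y) ((b t : E) - y') + dist ((b t : E) - y') (A ((e (b t) : ↥P) : E)) :=
        dist_triangle _ _ _
    _ ≤ θ + η := add_le_add (hb t) (he (b t))
    _ ≤ η' := hθη

/-- Shell congruence is translation covariant: the shell of `z` in `X - v = (· + v) ⁻¹' X` is
the translate of the shell of `z + v` in `X`, with the same recentred points. [folklore] -/
theorem good_preimage_add_const {X P : Set E} {z : E} {r η : ℝ} (v : E)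
    (h : ∃ A : E →ₗᵢ[ℝ] E, ∃ e : ↥{w | w ∈ X ∧ w ≠ z + v ∧ dist w (z + v) < r} ≃ ↥P,
      ∀ t : ↥{w | w ∈ X ∧ w ≠ z + v ∧ dist w (z + v) < r},
        dist ((t : E) - (z + v)) (A ((e t : ↥P) : E)) ≤ η) :
    ∃ A : E →ₗᵢ[ℝ] E, ∃ e : ↥{w | w ∈ (fun p => p + v) ⁻¹' X ∧ w ≠ z ∧ dist w z < r} ≃ ↥P,
      ∀ t : ↥{w | w ∈ (fun p => p + v) ⁻¹' X ∧ w ≠ z ∧ dist w z < r},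
        dist ((t : E) - z) (A ((e t : ↥P) : E)) ≤ η := by
  obtain ⟨b, hb⟩ := exists_shell_equiv_preimage_add_const X z v r
  refine good_transfer (θ := 0) (η := η) b (fun t => le_of_eq ?_) h (by rw [zero_add])
  rw [dist_eq_zero, hb t]
  abel

end Normed

/-! ## Shell congruence passes to local limits (in `ℝ³`) -/

/-- **Shell congruence passes to local limits.** Let `X_k → X` locally in `ℝ³` (two-way
`ε`-matching on every ball about `0`, eventually in `k`, for all `R` and `ε > 0`), all `X_k` and
`X` `δ`-separated (`δ > 0`), `r > 0`, and `P ⊆ ℝ³` a pattern of points of norm `< r`.  If for every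
`η > 0`, eventually in `k`, the `r`-shell of every point of `X_k` of norm `≤ ‖y‖ + 1` is
`η`-congruent to `P`, then the `r`-shell of `y ∈ X` is `η`-congruent to `P` for every `η > 0`.
[folklore] -/
theorem good_of_limit {Xs : ℕ → Set (EuclideanSpace ℝ (Fin 3))}
    {X P : Set (EuclideanSpace ℝ (Fin 3))} {δ r : ℝ} (hδ : 0 < δ) (hr : 0 < r)
    (hPr : ∀ p ∈ P, ‖p‖ < r)
    (hsepk : ∀ k, ∀ p ∈ Xs k, ∀ q ∈ Xs k, p ≠ q → δ ≤ dist p q)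
    (hsep : ∀ p ∈ X, ∀ q ∈ X, p ≠ q → δ ≤ dist p q)
    (hlim : ∀ R ε : ℝ, 0 < ε → ∀ᶠ k in atTop, BallMatch ε R 0 (Xs k) X)
    {y : EuclideanSpace ℝ (Fin 3)} (hy : y ∈ X)
    (hgood : ∀ η : ℝ, 0 < η → ∀ᶠ k in atTop, ∀ z ∈ Xs k, ‖z‖ ≤ ‖y‖ + 1 →
      ∃ A : EuclideanSpace ℝ (Fin 3) →ₗᵢ[ℝ] EuclideanSpace ℝ (Fin 3),
        ∃ e : ↥{w | w ∈ Xs k ∧ w ≠ z ∧ dist w z < r} ≃ ↥P,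
          ∀ t : ↥{w | w ∈ Xs k ∧ w ≠ z ∧ dist w z < r},
            dist ((t : EuclideanSpace ℝ (Fin 3)) - z)
              (A ((e t : ↥P) : EuclideanSpace ℝ (Fin 3))) ≤ η)
    {η : ℝ} (hη : 0 < η) :
    ∃ A : EuclideanSpace ℝ (Fin 3) →ₗᵢ[ℝ] EuclideanSpace ℝ (Fin 3),
      ∃ e : ↥{w | w ∈ X ∧ w ≠ y ∧ dist w y < r} ≃ ↥P,
        ∀ t : ↥{w | w ∈ X ∧ w ≠ y ∧ dist w y < r},
          dist ((t : EuclideanSpace ℝ (Fin 3)) - y) (A ((e t : ↥P) : EuclideanSpace ℝ (Fin 3))) ≤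
            η := by
  classical
  -- (0) `P` is finite: some shell of some `X_k` is in bijection with it
  have hPfin : P.Finite := by
    obtain ⟨k, hk1, hk2⟩ := ((hgood 1 one_pos).and (hlim ‖y‖ 1 one_pos)).exists
    obtain ⟨z, hz, hzy⟩ := hk2.1 y hy (by rw [dist_zero_right])
    have hzn : ‖z‖ ≤ ‖y‖ + 1 := by linarith [norm_le_norm_add_dist z y]
    obtain ⟨-, e, -⟩ := hk1 z hz hzn
    have hTfin :
        ({w | w ∈ Xs k ∧ w ≠ z ∧ dist w z < r} : Set (EuclideanSpace ℝ (Fin 3))).Finite :=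
      finite_of_forall_le_dist_of_subset_closedBall hδ
        (fun p hp q hq hpq => hsepk k p hp.1 q hq.1 hpq) (c := z) (R := r)
        fun w hw => mem_closedBall.2 hw.2.2.le
    have hTfin' : Finite ↥{w | w ∈ Xs k ∧ w ≠ z ∧ dist w z < r} := hTfin.to_subtype
    have : Finite ↥P := Finite.of_equiv _ e
    exact Set.toFinite P
  -- (1) margins: `‖p‖ + m ≤ r` on `P`, `dist t y + mT ≤ r` on the shell of `y`
  obtain ⟨m, hm0, hm⟩ := exists_margin_norm hPfin hr hPr
  have hTfin : ({w | w ∈ X ∧ w ≠ y ∧ dist w y < r} : Set (EuclideanSpace ℝ (Fin 3))).Finite :=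
    finite_of_forall_le_dist_of_subset_closedBall hδ
      (fun p hp q hq hpq => hsep p hp.1 q hq.1 hpq) (c := y) (R := r)
      fun w hw => mem_closedBall.2 hw.2.2.le
  obtain ⟨mT, hmT0, hmT⟩ := exists_margin_dist hTfin hr fun t ht => ht.2.2
  -- (2) tolerances: `η₁ ≤ min (η/2) (m/2)` for the approximating shells, `ε` for the matching
  obtain ⟨η₁, hη₁0, hη₁η, hη₁m, -, -, -⟩ :=
    exists_pos_le_five (a := η / 2) (b := m / 2) (c := 1) (d := 1) (e := 1)
      (by positivity) (by positivity) one_pos one_pos one_pos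
  obtain ⟨ε, hε0, hεδ, hεT, hεm, hεη, hε1⟩ :=
    exists_pos_le_five (a := δ / 4) (b := mT / 4) (c := m / 8) (d := η / 8) (e := 1)
      (by positivity) (by positivity) (by positivity) (by positivity) one_pos
  have h2ε : 2 * ε < δ := by linarith
  -- (3) a good index `k`, the partner `y'` of `y`, and the congruence of its shell
  obtain ⟨k, hk1, hk2⟩ := ((hgood η₁ hη₁0).and (hlim (‖y‖ + r + 1) ε hε0)).exists
  obtain ⟨y', hy', hy'y⟩ := hk2.1 y hy (by rw [dist_zero_right]; linarith)
  have hy'n : ‖y'‖ ≤ ‖y‖ + 1 := by linarith [norm_le_norm_add_dist y' y]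
  obtain ⟨A, e', he'⟩ := hk1 y' hy' hy'n
  -- points of the shell of `y'` are at distance `≤ r - m + η₁ < r - 2ε` from `y'`
  have hT'd : ∀ t' ∈ Xs k, t' ≠ y' → dist t' y' < r → dist t' y' + 2 * ε < r := by
    intro t' ht'X ht'y ht'r
    have h1 := he' ⟨t', ht'X, ht'y, ht'r⟩
    have h2 := hm _ (e' ⟨t', ht'X, ht'y, ht'r⟩).2
    have h4 : ‖t' - y'‖ ≤ ‖A ((e' ⟨t', ht'X, ht'y, ht'r⟩ : ↥P) : EuclideanSpace ℝ (Fin 3))‖ +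
        ‖t' - y' - A ((e' ⟨t', ht'X, ht'y, ht'r⟩ : ↥P) : EuclideanSpace ℝ (Fin 3))‖ := by
      linarith [norm_sub_norm_le (t' - y')
        (A ((e' ⟨t', ht'X, ht'y, ht'r⟩ : ↥P) : EuclideanSpace ℝ (Fin 3)))]
    rw [A.norm_map, ← dist_eq_norm, ← dist_eq_norm] at h4
    linarith
  have hTd : ∀ t ∈ X, t ≠ y → dist t y < r → dist t y + 2 * ε < r := by
    intro t htX hty htr
    linarith [hmT t ⟨htX, hty, htr⟩]
  -- (4) the matching bijection between the two shells, and transport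
  obtain ⟨b, hb⟩ := exists_matching_equiv hsep (hsepk k) h2ε hε1 hk2 hy hy' hy'y hTd hT'd
  exact good_transfer (θ := 2 * ε) (η := η₁) b hb ⟨A, e', he'⟩ (by linarith)

end Summit.AtomisticToContinuum.Crystallization.Theorems.HullExactShells

end
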